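import Literature.MathematicalPhysics.QuantumFieldTheory.Balaban1983to89.T4BoundaryRateWord

/-!
# BoundaryRateLayeredWord (part 1 of 3: the layered toy, chart, gauge, frame, fit) — THE LAYERED WORD FRAME: one word constraint PER LAYER in non-commuting letters, a convex layered
letter core inside it, `CollarDecay` of the layer-weighted translation chart, and §12's `FluctDampedOne` END TO END on the printed
radius factors (tree target `Summits/QuantumFields/BalabanUV/T4Continuum/Support/`, LEAN PLACEMENT RULE 2026-08-19: new cell work
lives under `Summits/`, published results only under `Literature/`; cell `pub-balaban`, T4-DAG §5 row T4-U3.E, spine estimate NE5,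
boundary-functional member — fan-out prover P3, lineage t4-ne5-p3 gen 13, the successor item §17(f)(2)(ii) «LAYERED WORDS» of the
cell record `t4/T4-EST-U3-NE5B-P3.md`; imports the Literature leaf `T4BoundaryRateWord` (v1.2.1) ONLY and modifies nothing of it, of
the Frame leaf, of the collar or of the parent `T4BoundaryRate`; SPLIT IN THREE MODULES of ≤ 400 lines (tree convention for
`Summits/` files): THIS part 1 = §(a)–(b), part 2 `BoundaryRateLayeredWordShapes` = §(c)–(e), part 3 `BoundaryRateLayeredWordPrinted`
= §(f)–(g), one namespace `Summit.QuantumFields.BalabanUV.T4Continuum.BoundaryRateLayeredWord` for all three; [folklore] kernel mathematics in an arbitrary complete complex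
normed algebra with `‖1‖ = 1`; 0 sorry; every located input a binder.  v1.0.1 (binder-row NE5 owner, lineage t4-ne5-p1 gen 21, after
the P3 lineage's retirement 2026-08-19): DOCSTRING-ONLY fix of the cell referee objection G-t4r2-111 — the two context spans that
printed the toy's layer indexing «n = 0, 1, …, j» inside quotation marks (module docstring PRINT paragraph; `lwdom`) now quote
[III] p. 261 verbatim, «on X∩(Ω_n∖Ω_{n+1}) for n = 1,…, j−1, or on X∩Ω_j for n = j», and state the re-indexing `m = n − 1` as the
module's own dictionary; every declaration, statement and proof byte-identical to v1 p194904.)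

HONEST FRAMING (T4-DAG PAGE 1; identical to the parent's).  The cell's T4 target is rung (B)+1: existence AND uniqueness of the
ε → 0 limit of Bałaban's unit-scale averaged loop expectations on a FIXED finite torus — strictly beyond ultraviolet stability,
NOT infinite volume, NOT a mass gap, NOT the Clay problem.  The boundary-functional member `T4BoundaryCarrier.NE5B` of the spine
estimate NE5 is a TWO-RUN statement and NOTHING OF IT IS PRINTED; it is not re-filed, re-worded or weakened here.  THIS MODULE IS A
TOY: elementary Banach-algebra and real arithmetic about LAYERED words — one `k`-letter word `(e^{A_{m,0}}u_{m,0})⋯(e^{A_{m,k−1}}u_{m,k−1})`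
per layer `m`, in background letters `u_{m,i}` of norm `≤ 1` perturbed by exponentials of «Lie-algebra» letters `A_{m,i}` — on which
the machine of `T4BoundaryRateCollar` §12 / `T4BoundaryRateFrame` §13i runs end to end.  It is NOT an encoding of Bałaban's spaces
(2.34)–(2.39) of [III] p. 261 and claims NOTHING about their shape; whether print's margins `β2^{−(j−n)}` survive for those spaces is
decided NOWHERE — not in print (ONE run), not here.  NOT summit progress.

WHAT IT ADDS (and why it is a separate module).  The Frame leaf's §13e (`printed_fluctDampedOne`) runs the machine end to end on
LAYERS of COMMUTING scalars (one letter `z_m ∈ ℂ` per layer, multiplicative chart); the Word leaf's §13l (`word_marginCauchy`) reaches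
`MarginCauchy` for ONE word in NON-COMMUTING letters with the layer index IDLE (no `CollarDecay`, no `GapShape`, no `FluctDampedOne`).
This module has both halves at once: layers AND non-commuting words — the layer seminorms, the per-layer word constraints with the
printed radius factors `(1 − β(1 − 2^{−(j−n)}))` as layer-dependent coefficients, the collar weights `δ^{X−m}` of the chart, hence
`CollarDecay`, `GapShape` with `ρ = 2` exactly, and `FluctDampedOne` through §12g's `fluctDampedOne_of_collar_normalized`.  The new
arithmetic fact is `log_room`: the convex letter cores of radius `log(1 + (r − r₀))` (§13k `wordCore_subset_wordDom`) keep at least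
HALF of the difference of the word radii (`r ≤ 1`), so the printed halving survives the non-commutative radius loss at the cost of a
factor `2` in the rooms (the circles' room is a QUARTER of the printed difference, `lwPrintedGap`, against §13e's half) and of the
smallness `s ≤ β/16` (against §13e's `β/64` in other units: here the amplitude `s` is relative to the layer unit `a·α_m`).

CONTENT [folklore] / [bookkeeping].  §(a) the layered toy: `lwCarriers` (pieces `Fin (N+1)`, backgrounds `(Fin (N+1) → Fin k → 𝔸) × Fin 2`),
`lwGeneration` (every older index a parent, zero kernels), the layered letter cores `lwcore` (per layer `m ≤ Y` the letter-ℓ¹-ball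
of radius `ℓ Y m`), the layered word domains `lwdom` (per layer `m ≤ Y` the word constraint of radius `r Y m` about the layer's
background word), the core radii `lcoreR u k r j m = log(1 + (r j m − ‖u_{m,0}⋯u_{m,k−1} − 1‖))`; §(b) the chart `lwChart` (amplitudes
`Σ_i‖𝒜_i‖ ≤ s`; chart `A_m ↦ A_m + (υ m·δ^{X−m})·𝒜` on every layer `m ≤ X`, layer units `υ`), the layer gauge `lwGauge` (letter sum
of the difference on the layer), the frame `lwFrame` (layer seminorm = letter sum of the layer, `pt z i = (z, i)`, displacement the
layer-weighted amplitude, domains `lwdom`), the NAMED SMALLNESS BINDER `LWordFits` (`c X m + υ m·s·δ^{X−m} + gap X Y (Y − m) ≤ ℓ Y m`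
for `m ≤ Y < X`); §(c) the frame shapes (F-Ch)/(F-Co)/(F-G) by bookkeeping, (F-M)/(F-E) OF THE LAYERED CORES from the fit
(`lw_core_frameMargin`, `lw_core_frameEndMargin`) and the SHARPNESS `lw_core_frameEndMargin_iff` ((F-E) of the cores ⟺ the fit; at
least one letter), the admissible class `LwAdmT` ((F-An) on the layered word domains); §(d) THE HOOK, LAYERED: `lwcore_subset_dom`
(§13k's inclusion layer by layer), `lw_framePath` (§12f's (F-P) via `T4BoundaryRateFrame.framePath_of_convexCore`), `lw_marginCauchy`
(§11's `MarginCauchy`, `c₀ = 2`, via `marginCauchy_of_convexCore`); §(e) `CollarDecay` of the layered chart (`lw_dist_chart`,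
`lw_collarDecay_rescale` — normalized, `ε = S·s` for units `υ ≤ S·ω` —, `lw_collarDecay`, `lwPrinted_collarDecay` — `ε = a·s` in
coefficient units for `υ m = a·α m`); §(f) END TO END on the printed factors: `lwPrintedGap` (quarter rooms), `log_room`,
`lwPrinted_fits` (the layered fit at the core radii of the printed radii `T4BoundaryRateFrame.printedR a β α`, for `a·α ≤ 1`,
`δ ≤ ½`, `s ≤ β/4`), `lwPrinted_marginCauchy`, `lwPrinted_fluctDampedOne` (`FluctDampedOne` with profile
`layeredSigma (lwCarriers 𝔸 k N) (16·s/β) δ 2` for `s ≤ β/16`), `lwPrinted_hr_one` / `lwPrinted_fluctDampedOne_one` (trivial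
background: the numerical hypotheses alone, jointly satisfiable with print's `β = 1/4`); §(g) non-vacuity (`lwPrinted_nonvacuous`)
and the NEGATIVE CONTROL `lwdom_one_not_convex` (NO layered word domain about the trivial background is convex — any number `≥ 1` of
letters, of layers, any positive radii — by pull-back along the layer-`0` injection to the Word leaf's `wdom_one_not_convex`), so
§12h's `framePath_of_convex` does not apply and §13i's device is what `lw_framePath` uses.

PRINT, FOR CONTEXT ONLY (quotations already certified in the lineage's cross-reads of the parent, the collar, the Frame and the
Word leaves; they locate an ANALOGY and assert nothing).  [III] = [Balaban1988Convergent] p. 261: *"(i) 𝐔 = U′U, U has values in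
the group G"*, (2.34) *"|∂U − 1|, |∂𝐔 − 1| < (1 − β(1 − 2^{−(j−n)}))α_{0,n}ξ²(Lⁿξ)^{−2}"* imposed *"on X∩(Ω_n∖Ω_{n+1}) for n = 1,…, j−1,
or on X∩Ω_j for n = j"* (the clause printed after (2.37) and again after (2.39); print indexes the layers `n = 1, …, j`, the top layer
being `X∩Ω_j` — the toy's layer index `m = 0, …, N` of §(a) is THIS MODULE'S OWN DICTIONARY `m = n − 1`, `N = j − 1`, not a quotation;
v1.0.1 DOCFIX of the cell referee objection G-t4r2-111, which v1 invited by printing the toy's indexing inside quotation marks),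
*"(iii) U′ = exp iξA′, A′ has values in the algebra 𝐠^c,"*; p. 277: *"we have to use a part of the analyticity domains of terms in
𝐁_k for the function 𝐇_k. This is the reason for putting the powers of 1/2 in the conditions (2.36)–(2.39). The analyticity domains
become smaller after each step, but the difference is very small and exponentially decreasing in the number of steps."*; [I] =
[Balaban1987RG1] p. 273: *"To get an analytic extension of (3.7) we substitute 𝐀 = 𝐇_j(B(t)) + t_□⟨…⟩"*, *"We assume also that ε₁
is so small that 𝐇_j(B(t)) satisfies (3.14) with 1/3α₂ on the right-hand side."*, (3.17) *"|(3.15)| ≤ (1/r)E₀exp(−κd_j(X))"*.  The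
dictionary «layer `m` ↔ `Ω_m∖Ω_{m+1}`, `u_{m,i}` ↔ `U(b)`, `A_{m,i}` ↔ `iξA′(b)`, the layer-`m` word ↔ a plaquette variable `∂𝐔` in
that layer, `r j m` ↔ the right side of (2.34) with the index `j`, `υ m` ↔ the layer's unit, `δ^{X−m}` ↔ the decay of the
fluctuation step's influence on older layers» is an ANALOGY exactly as in the Word leaf's header: print's (2.34)–(2.35) also constrain
AVERAGED configurations, nonlinear in `𝐔`, and (2.39) bounds a covariant derivative; nothing here encodes either.

ABSOLUTE RULE.  Every declaration is [folklore] (kernel-checked elementary analysis) or [bookkeeping] (structures, set and radius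
definitions, `rfl`-lemmas); no `sorry`, no axiom beyond the standard triple, no hypothesis of statement type; print appears in
docstrings only, as CONTEXT; no internally-minted statement is cited as a fact; nothing of Bałaban's run is derived from print.
Used BY NAME — Word leaf: `wordDom`, `wordCore_subset_wordDom`, `zero_mem_wordDom`, `oprod_one`, `seqOf`, `seqOf_zero`, `wcore`,
`mem_wcore_iff`, `zero_mem_wcore`, `wcore_convex`, `coreR`, `coreR_pos`, `l1Semi`, `sum_norm_smul_single`, `wdom_one_not_convex`;
Frame leaf: `lay`, `lay_coe`, `lay_val_of_le`, `cw`, `cw_of_le`, `printedR`, `printedR_pos`, `shrink_sub_shrink_pos`,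
`framePath_of_convexCore`, `marginCauchy_of_convexCore`, `withDom`; collar: `CplxFrame`, `FrameChart`, `FrameCore`, `FrameGauge`,
`FrameMargin`, `FrameEndMargin`, `FramePath`, `FrameAnalytic`, `MarginCauchy`, `LayerGauge`, `LayerGauge.rescale`,
`LayerGauge.rescale_dist`, `CollarDecay`, `layeredSigma`, `fluctDampedOne_of_collar_normalized`; parent: `Generation`, `BTable`,
`cpart`, `FluctChart`, `FluctDampedOne`; `T4BoundaryCarrier.Carriers`; `B7Prop6Bound.oprod`; `B14Radii.shrink`, `shrink_antitone`,
`shrink_le_one`; Mathlib: `Seminorm.comp` (as `(l1Semi 𝔸 k).comp`), `LinearMap.proj`, `Pi.single`, `Convex.is_linear_preimage`, `Real.log_div`,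
`Real.log_le_sub_one_of_pos`, `div_le_div_of_nonneg_left`, `pow_le_pow_left₀`, `pow_le_pow_of_le_one`, `norm_smul`.  Cell record
`t4/T4-EST-U3-NE5B-P3.md` §18 (gen 13).
[cite: Balaban1988Convergent, (2.34)–(2.39) p.261, (2.41) p.261, p.277; Balaban1987RG1, (3.4) p.270, p.271, (3.14)–(3.17) p.272–273]
-/

namespace Summit.QuantumFields.BalabanUV.T4Continuum.BoundaryRateLayeredWord

open Finset NormedSpace
open Literature.MathematicalPhysics.QuantumFieldTheory.Balaban1983to89
open B7Prop6Bound T4OutputRate T4BoundaryCarrier T4BoundaryRate T4BoundaryRateCollar T4BoundaryRateFrame T4BoundaryRateWord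

/-! ### §(a) The layered toy: carriers, generation, layered word domains and letter cores -/

/-- THE LAYERED WORD CARRIERS [bookkeeping]: pieces = indices `Fin (N+1)` (`scale = id`, `d = 0`), backgrounds of both runs = ONE
`k`-letter word PER LAYER, `(Fin (N+1) → Fin k → 𝔸) × Fin 2` (letters in Lie-algebra coordinates, layer by layer, and the Re/Im
reading tag of §8), `transport = id`, one fluctuation label.  A TOY: nothing of Bałaban's. [folklore] -/
abbrev lwCarriers (𝔸 : Type) (k N : ℕ) : T4BoundaryCarrier.Carriers where
  Dom := Fin (N + 1)
  scale := fun X => (X : ℕ)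
  d := fun _ => 0
  d_nonneg := fun _ => le_rfl
  BgA := (Fin (N + 1) → Fin k → 𝔸) × Fin 2
  BgB := (Fin (N + 1) → Fin k → 𝔸) × Fin 2
  gauge := fun _ _ => 0
  gauge_nonneg := fun _ _ => le_rfl
  transport := fun U => U
  Fl := Unit
  admFl := Set.univ

/-- The toy generation [bookkeeping]: every strictly older index is a parent, no E-parents, zero kernels. [folklore] -/
def lwGeneration (𝔸 : Type) (k N : ℕ) : Generation (lwCarriers 𝔸 k N) where
  parents := fun X => Finset.univ.filter (fun Y => Y < X)
  parents_lt := fun X Y hY => (mem_filter.mp hY).2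
  eparents := fun _ => ∅
  eparents_lt := fun _ _ h => by simp at h
  K := fun _ _ => 0
  K_nonneg := fun _ _ => le_rfl
  KE := fun _ _ => 0
  KE_nonneg := fun _ _ => le_rfl

/-- [bookkeeping] [folklore] -/
theorem lw_mem_parents_iff {𝔸 : Type} {k N : ℕ} (X Y : Fin (N + 1)) :
    Y ∈ (lwGeneration 𝔸 k N).parents X ↔ Y < X := by
  simp [lwGeneration]

section Layered

variable {𝔸 : Type} [NormedRing 𝔸]

variable (𝔸) in
/-- THE LAYERED LETTER CORE of the index `Y` [bookkeeping]: layered words whose layer-`m` word, for every layer `m ≤ Y`, has letter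
sum `< ℓ Y m` (§13l's `wcore` layer by layer; the layers above `Y` are free). [folklore] -/
def lwcore (k N : ℕ) (ℓ : ℕ → ℕ → ℝ) (Y : Fin (N + 1)) : Set (Fin (N + 1) → Fin k → 𝔸) :=
  {A | ∀ m : Fin (N + 1), m ≤ Y → A m ∈ wcore 𝔸 k (ℓ Y m)}

/-- THE LAYERED WORD DOMAIN of the index `Y` [bookkeeping]: layered words whose layer-`m` word, for every layer `m ≤ Y`, meets the
word constraint of radius `r Y m` about the layer's background word `u_m,0⋯u_m,k−1`:
`‖(e^{A_{m,0}}u_{m,0})⋯(e^{A_{m,k−1}}u_{m,k−1}) − 1‖ < r Y m` (§13k's `wordDom` layer by layer) — the toy reading of ONE constraint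
(2.34) *"|∂U − 1|, |∂𝐔 − 1| < (1 − β(1 − 2^{−(j−n)}))α_{0,n}ξ²(Lⁿξ)^{−2}"* PER LAYER, print's layers being *"on X∩(Ω_n∖Ω_{n+1}) for
n = 1,…, j−1, or on X∩Ω_j for n = j"* ([III] p. 261, after (2.37) and after (2.39); the toy's layers `m = 0, …, N` ↔ print's
`n = 1, …, j` by `m = n − 1` is this module's own dictionary (v1.0.1 DOCFIX, G-t4r2-111); ANALOGY, CONTEXT only; no encoding of
(2.34)–(2.39) is proposed). [cite: Balaban1988Convergent, (2.34) p.261] -/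
def lwdom (k N : ℕ) (u : ℕ → ℕ → 𝔸) (r : ℕ → ℕ → ℝ) (Y : Fin (N + 1)) : Set (Fin (N + 1) → Fin k → 𝔸) :=
  {A | ∀ m : Fin (N + 1), m ≤ Y → seqOf (A m) ∈ wordDom (u m) k (r Y m)}

/-- THE LAYERED CORE RADII [bookkeeping]: `lcoreR u k r j m = log(1 + (r j m − ‖u_{m,0}⋯u_{m,k−1} − 1‖))` — §13l's `coreR` for the
layer-`m` background word and the radius table `j ↦ r j m`. [folklore] -/
noncomputable def lcoreR (u : ℕ → ℕ → 𝔸) (k : ℕ) (r : ℕ → ℕ → ℝ) : ℕ → ℕ → ℝ :=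
  fun j m => coreR (u m) k (fun j' => r j' m) j

/-- [bookkeeping] [folklore] -/
theorem lcoreR_eq (u : ℕ → ℕ → 𝔸) (k : ℕ) (r : ℕ → ℕ → ℝ) (j m : ℕ) :
    lcoreR u k r j m = Real.log (1 + (r j m - ‖oprod (u m) k - 1‖)) := rfl

/-- The layered core radii are POSITIVE as soon as every layer's background word is within its radius. [folklore] -/
theorem lcoreR_pos {u : ℕ → ℕ → 𝔸} {k : ℕ} {r : ℕ → ℕ → ℝ} {j m : ℕ} (h : ‖oprod (u m) k - 1‖ < r j m) :
    0 < lcoreR u k r j m :=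
  coreR_pos (r := fun j' => r j' m) h

/-- `0` is in every layered core with positive radii. [folklore] -/
theorem zero_mem_lwcore (k N : ℕ) {ℓ : ℕ → ℕ → ℝ} {Y : Fin (N + 1)} (h : ∀ m : Fin (N + 1), m ≤ Y → 0 < ℓ Y m) :
    (0 : Fin (N + 1) → Fin k → 𝔸) ∈ lwcore 𝔸 k N ℓ Y :=
  fun m hm => zero_mem_wcore k (h m hm)

/-- The layer letter sums of a ONE-LAYER layered word `Pi.single m v` [folklore]: `Σ_i ‖v_i‖` on the layer `m`, `0` elsewhere. -/
theorem sum_norm_single_layer {k N : ℕ} (m m' : Fin (N + 1)) (v : Fin k → 𝔸) :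
    ∑ i, ‖(Pi.single m v : Fin (N + 1) → Fin k → 𝔸) m' i‖ = if m' = m then ∑ i, ‖v i‖ else 0 := by
  by_cases h : m' = m
  · subst h; simp
  · simp [h]

end Layered

/-! ### §(b) The layered chart (layer-unit translation with collar weights), gauge, frame and fit -/

section LayeredFrame

variable {𝔸 : Type} [NormedRing 𝔸] [NormedAlgebra ℂ 𝔸]

variable (𝔸) in
/-- **THE LAYERED LETTER CHART** [bookkeeping]: amplitudes = letter vectors `𝒜` with `Σ_i ‖𝒜_i‖ ≤ s`; core of the step of index `X` =
layered words with layer-`m` letter sum `< c X m` for every `m ≤ X`; the chart TRANSLATES the letters of EVERY layer `m ≤ X` by the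
amplitude weighted by the layer's unit `υ m` and the COLLAR WEIGHT `δ^{X−m}` (`cw`, §13a): `A_m ↦ A_m + (υ m·δ^{X−m})·𝒜` (nothing above
`X`).  The affine face of §13a's `expChart` (there `z_m ↦ z_m·e^{δ^{X−m}w}`) in Lie-algebra letters; print's per-layer decay of the
fluctuation step's influence, [III] p. 277 *"the difference is very small and exponentially decreasing in the number of steps"*
(ANALOGY; CONTEXT only; nothing of Bałaban's). [cite: Balaban1988Convergent, p.277; Balaban1987RG1, (3.4) p.270] -/
noncomputable def lwChart (k N : ℕ) (c : ℕ → ℕ → ℝ) (υ : ℕ → ℝ) (δ s : ℝ) :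
    FluctChart (lwCarriers 𝔸 k N) (Fin k → 𝔸) where
  supp := fun _ => {𝒜 | ∑ i, ‖𝒜 i‖ ≤ s}
  core := fun X => {U | ∀ m : Fin (N + 1), m ≤ X → ∑ i, ‖U.1 m i‖ < c X m}
  chart := fun X U 𝒜 => (fun m => U.1 m + (υ m * cw δ X m) • 𝒜, U.2)
  zero := 0
  chart_zero := fun X U => Prod.ext (funext fun m => by simp) rfl

variable (𝔸) in
/-- THE LAYERED LETTER GAUGE [bookkeeping]: `dist n U′ U = Σ_i ‖U′_{n,i} − U_{n,i}‖`, the letter sum of the difference ON THE LAYER `n`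
(`lay`, §13a). [folklore] -/
noncomputable def lwGauge (k N : ℕ) : LayerGauge (lwCarriers 𝔸 k N) where
  dist := fun n U' U => ∑ i, ‖U'.1 (lay N n) i - U.1 (lay N n) i‖
  dist_nonneg := fun _ _ _ => sum_nonneg fun i _ => norm_nonneg _
  dist_self := fun _ _ => by simp

/-- **THE LAYERED WORD FRAME** [bookkeeping]: `E = Fin (N+1) → Fin k → 𝔸` (sup norm, `NormedSpace ℂ`), the seminorm of the layer `n`
the letter sum of that layer (`l1Semi ∘ proj (lay N n)`), `pt z i = (z, i)`, displacement = the layer-weighted amplitude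
`m ↦ (υ m·δ^{X−m})·𝒜`, and the encoded domain of the index `Y` THE LAYERED WORD DOMAIN `lwdom` (one word constraint per layer
`m ≤ Y`). [folklore] -/
noncomputable def lwFrame (k N : ℕ) (υ : ℕ → ℝ) (δ : ℝ) (u : ℕ → ℕ → 𝔸) (r : ℕ → ℕ → ℝ) :
    CplxFrame (lwCarriers 𝔸 k N) (Fin k → 𝔸) (Fin (N + 1) → Fin k → 𝔸) where
  semi := fun n => (l1Semi 𝔸 k).comp (LinearMap.proj (lay N n))
  pt := fun z i => (z, i)
  disp := fun X _ 𝒜 => fun m => (υ m * cw δ X m) • 𝒜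
  dom := lwdom k N u r

/-- [bookkeeping] [folklore] -/
@[simp] theorem lwFrame_semi_apply (k N : ℕ) (υ : ℕ → ℝ) (δ : ℝ) (u : ℕ → ℕ → 𝔸) (r : ℕ → ℕ → ℝ) (n : ℕ)
    (v : Fin (N + 1) → Fin k → 𝔸) : (lwFrame k N υ δ u r).semi n v = ∑ i, ‖v (lay N n) i‖ := rfl

/-- [bookkeeping] [folklore] -/
theorem lwFrame_dom (k N : ℕ) (υ : ℕ → ℝ) (δ : ℝ) (u : ℕ → ℕ → 𝔸) (r : ℕ → ℕ → ℝ) :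
    (lwFrame k N υ δ u r).dom = lwdom k N u r := rfl

/-- **THE LAYERED WORD FIT** — the toy's NAMED SMALLNESS BINDER [bookkeeping]: for every parent `Y < X` and every layer `m ≤ Y`, the
step-`X` core radius plus the layer's displacement bound `υ m·s·δ^{X−m}` plus the circles' room on that layer fits inside the CORE
radius of the parent: `c X m + υ m·s·δ^{X−m} + gap X Y (Y − m) ≤ ℓ Y m` — §13a's `PathFits` in Lie-algebra letters (additive), one
word per layer.  Asserted for nothing of Bałaban's ([I] p. 273 *"We assume also that ε₁ is so small that 𝐇_j(B(t)) satisfies (3.14)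
with 1/3α₂ on the right-hand side."*; CONTEXT only). [cite: Balaban1987RG1, (3.14) p.272, p.273; Balaban1988Convergent, p.277] -/
def LWordFits (N : ℕ) (c : ℕ → ℕ → ℝ) (υ : ℕ → ℝ) (δ s : ℝ) (gap : Fin (N + 1) → Fin (N + 1) → ℕ → ℝ)
    (ℓ : ℕ → ℕ → ℝ) : Prop :=
  ∀ X Y : Fin (N + 1), Y < X → ∀ m : Fin (N + 1), m ≤ Y →
    c X m + υ m * s * δ ^ ((X : ℕ) - m) + gap X Y ((Y : ℕ) - m) ≤ ℓ Y m

end LayeredFrame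

end Summit.QuantumFields.BalabanUV.T4Continuum.BoundaryRateLayeredWord
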